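import Summits.NavierStokesRegularity.NavierStokesRegularity.Theses.FilamentSkeletonRss

/-!
# `CoreGluing` (stmt-NavierStokesRegularity-15401): the stretching threshold is the load-bearing clause

Negative-side support for crux `CoreGluing := SkeletonEquilibrium → RssProfileExists` of route
`FilamentSkeletonRss` (cdisprove seat, cycle 1, 2026-08-16).  Two kernel-checked facts for provers and
planners:

* `not_coreGluing_iff` — the crux is a material implication between two CLOSED propositions, so
  `¬ CoreGluing ↔ SkeletonEquilibrium ∧ ¬ RssProfileExists`: refuting it means proving BOTH the 2001
  skeleton theorem (crux stmt-15400) AND the rotating-self-similar Liouville theorem in the filament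
  window `α ≈ 1` (Tsai Conj. 8.9 = Pineau–Vicol Conj. 1.1, open); conversely a proof of `CoreGluing`
  that does not consume the skeleton is a proof of the open target `RssProfileExists` outright.
* `skeletonEquilibrium_holds_below_drift` — every clause of the hypothesis `SkeletonEquilibrium` EXCEPT
  the supercritical threshold `3/2 + δ ≤ w′(τ*)` is inhabited, for every `Γ`, by the bare rotation
  axis `Ξ(τ) = τ e₃` with tangential speed `w(τ) = τ/2` (pure Leray drift, `w′ ≡ 1/2`): unit speed,
  zero curvature, proper, regularised Biot–Savart self-induction `≡ 0`, `e₃ × Ξ = 0`, unique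
  stagnation point `τ* = 0`.  Hence the statement with `3/2` replaced by any `θ < 1/2` (written
  INLINE below; it is `SkeletonEquilibriumAt θ` of the crux workfile
  `Cruxes/CoreGluing/Disproof.lean`, and at `θ = 3/2` it is `SkeletonEquilibrium` verbatim) is TRUE,
  and the correspondingly weakened crux is equivalent to `RssProfileExists`
  (`coreGluing_below_drift_iff_rssProfileExists`).  Any proof of `CoreGluing` must therefore use
  supercriticality `w′(τ*) > 3/2` — the positivity of the Burgers core area `A = 4/(w′ − 3/2)`
  (support item `CoreAreaNecessity`); an argument insensitive to the threshold proves the open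
  target.
-/

set_option linter.dupNamespace false

namespace Summit.NavierStokesRegularity.NavierStokesRegularity.Theorems.CoreGluing.Negative

open Summit.NavierStokesRegularity.NavierStokesRegularity.Theses.FilamentSkeletonRss
open Literature.Analysis.FluidPDE MeasureTheory

/-- A refutation of `CoreGluing` is EXACTLY "skeleton theorem ∧ RSS Liouville theorem in the
filament window" (both closed propositions; the second is Perelman's open conjecture). [folklore] -/
theorem not_coreGluing_iff : ¬ CoreGluing ↔ (SkeletonEquilibrium ∧ ¬ RssProfileExists) := by
  unfold CoreGluing
  exact Classical.not_imp

/-- **The axis witness: `SkeletonEquilibrium` holds trivially below the Leray-drift threshold.**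
The statement is `SkeletonEquilibrium` VERBATIM with the last clause `3 / 2 + δ ≤ deriv (w j) τs`
replaced by `θ + δ ≤ deriv (w j) τs`, for every `θ < 1/2`; witness `N = 1`, `γ ≡ 1`, `α = 1`,
`δ = 1/2 − θ`, `ρ = 1`, `K = 0`, `Γ = max Γ₀ 1`, `Ξ(τ) = τ e₃`, `w(τ) = τ/2`, `τ* = 0`. So the
supercritical threshold is the ONLY clause of the crux's hypothesis not inhabited by a
vorticity-free junk object. [folklore] -/
theorem skeletonEquilibrium_holds_below_drift {θ : ℝ} (hθ : θ < 1 / 2) :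
    ∃ (N : ℕ) (γ : Fin N → ℝ) (α δ ρ K : ℝ), 0 < N ∧ α ≠ 0 ∧ 0 < δ ∧ 0 < ρ ∧ (∀ j, γ j ≠ 0) ∧ ∀ Γ₀ : ℝ, ∃ Γ : ℝ, Γ₀ ≤ Γ ∧ 0 < Γ ∧ ∃ (Ξ : Fin N → ℝ → EuclideanSpace ℝ (Fin 3)) (w : Fin N → ℝ → ℝ), (∀ j, ContDiff ℝ 2 (Ξ j) ∧ Function.Injective (Ξ j) ∧ Differentiable ℝ (w j) ∧ (∀ τ, ‖deriv (Ξ j) τ‖ = 1) ∧ (∀ τ, ‖iteratedDeriv 2 (Ξ j) τ‖ * Real.sqrt Γ ≤ K) ∧ Filter.Tendsto (fun τ => ‖Ξ j τ‖) Filter.atTop Filter.atTop ∧ Filter.Tendsto (fun τ => ‖Ξ j τ‖) Filter.atBot Filter.atTop) ∧ (∀ j k, j ≠ k → ∀ τ σ, ρ * Real.sqrt Γ ≤ ‖Ξ j τ - Ξ k σ‖) ∧ (∀ j (x : EuclideanSpace ℝ (Fin 3)), MeasureTheory.Integrable (fun σ : ℝ => ((‖x - Ξ j σ‖ ^ 2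 + 1) ^ (3 / 2 : ℝ))⁻¹ • Literature.Analysis.FluidPDE.cross (deriv (Ξ j) σ) (x - Ξ j σ))) ∧ (∀ j τ, (∑ k : Fin N, (Γ * γ k / (4 * Real.pi)) • ∫ σ : ℝ, ((‖Ξ j τ - Ξ k σ‖ ^ 2 + 1) ^ (3 / 2 : ℝ))⁻¹ • Literature.Analysis.FluidPDE.cross (deriv (Ξ k) σ) (Ξ j τ - Ξ k σ)) + (1 / 2 : ℝ) • Ξ j τ - α • Literature.Analysis.FluidPDE.cross (EuclideanSpace.single (2 : Fin 3) (1 : ℝ)) (Ξ j τ) = w j τ • deriv (Ξ j) τ) ∧ (∀ j, ∃ τs : ℝ, w j τs = 0 ∧ (∀ τ, w j τ = 0 → τ = τs) ∧ θ + δ ≤ deriv (w j) τs) := by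
  classical
  -- bilinearity of the tree's cross product (local copies: the landed `windCross_*` lemmas live in a
  -- module importing another route's Theses file, which a Negative helper must not drag in)
  have cross_smul_right : ∀ (a b : EuclideanSpace ℝ (Fin 3)) (r : ℝ),
      cross a (r • b) = r • cross a b := fun a b r => by simp [cross, map_smul]
  have cross_sub_right : ∀ (a b c : EuclideanSpace ℝ (Fin 3)),
      cross a (b - c) = cross a b - cross a c := fun a b c => by simp [cross, map_sub]
  have cross_self_eq_zero : ∀ a : EuclideanSpace ℝ (Fin 3), cross a a = 0 := fun a => by
    simp [cross]
  set e₃ : EuclideanSpace ℝ (Fin 3) := EuclideanSpace.single (2 : Fin 3) (1 : ℝ) with he₃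
  have hne₃ : ‖e₃‖ = 1 := by simp [he₃]
  have he₃0 : e₃ ≠ 0 := by
    intro h; rw [h, norm_zero] at hne₃; exact zero_ne_one hne₃
  -- the axis and its speed
  set Ξ₀ : ℝ → EuclideanSpace ℝ (Fin 3) := fun τ => τ • e₃ with hΞ₀
  have hderiv : deriv Ξ₀ = fun _ => e₃ := by
    funext τ
    rw [hΞ₀, deriv_smul_const differentiableAt_id, deriv_id'', one_smul]
  have hderiv2 : iteratedDeriv 2 Ξ₀ = fun _ => 0 := by
    rw [iteratedDeriv_succ, iteratedDeriv_one, hderiv]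
    funext τ
    exact deriv_const τ e₃
  refine ⟨1, fun _ => 1, 1, 1 / 2 - θ, 1, 0, Nat.one_pos, one_ne_zero, by linarith, one_pos,
    fun _ => one_ne_zero, fun Γ₀ => ⟨max Γ₀ 1, le_max_left _ _, lt_of_lt_of_le one_pos (le_max_right _ _),
    fun _ => Ξ₀, fun _ τ => τ / 2, ?_, ?_, ?_, ?_, ?_⟩⟩
  · -- regularity, unit speed, zero curvature, properness
    intro j
    refine ⟨contDiff_id.smul contDiff_const, smul_left_injective ℝ he₃0,
      differentiable_id.div_const _, fun τ => by rw [hderiv, hne₃], fun τ => ?_, ?_, ?_⟩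
    · rw [hderiv2]; simp
    · have : (fun τ : ℝ => ‖Ξ₀ τ‖) = fun τ => |τ| := by
        funext τ; simp [hΞ₀, norm_smul, hne₃]
      rw [this]; exact Filter.tendsto_abs_atTop_atTop
    · have : (fun τ : ℝ => ‖Ξ₀ τ‖) = fun τ => |τ| := by
        funext τ; simp [hΞ₀, norm_smul, hne₃]
      rw [this]; exact Filter.tendsto_abs_atBot_atTop
  · -- pairwise separation: vacuous for one filament
    intro j k hjk
    exact absurd (Subsingleton.elim j k) hjk
  · -- integrability of the regularised Biot–Savart integrand at every point
    intro j x
    have hcross : ∀ σ : ℝ, cross (deriv Ξ₀ σ) (x - Ξ₀ σ) = cross e₃ x := by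
      intro σ
      rw [hderiv]
      simp only [hΞ₀]
      rw [cross_sub_right, cross_smul_right, cross_self_eq_zero, smul_zero, sub_zero]
    simp_rw [hcross]
    refine Integrable.smul_const ?_ _
    -- domination by the integrable Cauchy kernel `(1 + (σ - x₂)²)⁻¹`
    have hcoord : ∀ σ : ℝ, (x 2 - σ) ^ 2 + 1 ≤ ‖x - Ξ₀ σ‖ ^ 2 + 1 := by
      intro σ
      have h2 : (x - Ξ₀ σ) 2 = x 2 - σ := by
        simp [hΞ₀, he₃]
      have := EuclideanSpace.norm_sq_eq (x - Ξ₀ σ)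
      rw [this]
      have hle : ‖(x - Ξ₀ σ) 2‖ ^ 2 ≤ ∑ i, ‖(x - Ξ₀ σ) i‖ ^ 2 :=
        Finset.single_le_sum (f := fun i => ‖(x - Ξ₀ σ) i‖ ^ 2) (fun i _ => sq_nonneg _)
          (Finset.mem_univ 2)
      rw [h2, Real.norm_eq_abs, sq_abs] at hle
      linarith
    have hcont : Continuous fun σ : ℝ => ((‖x - Ξ₀ σ‖ ^ 2 + 1) ^ (3 / 2 : ℝ))⁻¹ := by
      have hc : Continuous fun σ : ℝ => ‖x - Ξ₀ σ‖ ^ 2 + 1 := by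
        simp only [hΞ₀]; fun_prop
      refine (hc.rpow_const fun σ => Or.inr (by norm_num)).inv₀ fun σ => ?_
      exact (Real.rpow_pos_of_pos (by positivity) _).ne'
    refine Integrable.mono' ((integrable_inv_one_add_sq).comp_sub_right (x 2))
      hcont.aestronglyMeasurable (Filter.Eventually.of_forall fun σ => ?_)
    have hb1 : 1 ≤ ‖x - Ξ₀ σ‖ ^ 2 + 1 := by nlinarith [sq_nonneg ‖x - Ξ₀ σ‖]
    have hbpos : 0 < ‖x - Ξ₀ σ‖ ^ 2 + 1 := by positivity
    rw [Real.norm_eq_abs, abs_of_nonneg (inv_nonneg.2 (Real.rpow_nonneg hbpos.le _))]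
    calc ((‖x - Ξ₀ σ‖ ^ 2 + 1) ^ (3 / 2 : ℝ))⁻¹ ≤ (‖x - Ξ₀ σ‖ ^ 2 + 1)⁻¹ := by
          refine inv_anti₀ hbpos ?_
          conv_lhs => rw [← Real.rpow_one (‖x - Ξ₀ σ‖ ^ 2 + 1)]
          exact Real.rpow_le_rpow_of_exponent_le hb1 (by norm_num)
      _ ≤ ((x 2 - σ) ^ 2 + 1)⁻¹ := inv_anti₀ (by positivity) (hcoord σ)
      _ = (1 + (σ - x 2) ^ 2)⁻¹ := by ring
  · -- the relative-equilibrium identity: ½ τ e₃ = (τ/2) e₃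
    intro j τ
    have hcross : ∀ σ : ℝ, cross (deriv Ξ₀ σ) (Ξ₀ τ - Ξ₀ σ) = 0 := by
      intro σ
      rw [hderiv]
      simp only [hΞ₀]
      rw [← sub_smul, cross_smul_right, cross_self_eq_zero, smul_zero]
    have haxis : cross (EuclideanSpace.single (2 : Fin 3) (1 : ℝ)) (Ξ₀ τ) = 0 := by
      simp only [hΞ₀]
      rw [cross_smul_right, ← he₃, cross_self_eq_zero, smul_zero]
    have hint : (∫ σ : ℝ, ((‖Ξ₀ τ - Ξ₀ σ‖ ^ 2 + 1) ^ (3 / 2 : ℝ))⁻¹ • cross (deriv Ξ₀ σ) (Ξ₀ τ - Ξ₀ σ))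
        = 0 := by
      simp_rw [hcross, smul_zero, integral_zero]
    beta_reduce
    rw [Finset.sum_eq_zero (fun k _ => by rw [hint, smul_zero]), zero_add, haxis, smul_zero, sub_zero,
      hderiv]
    simp only [hΞ₀, smul_smul]
    congr 1
    ring
  · -- unique stagnation point τ* = 0 with w′(0) = 1/2 = θ + δ
    intro j
    refine ⟨0, by norm_num, fun τ hτ => by linarith, ?_⟩
    have : deriv (fun τ : ℝ => τ / 2) 0 = 1 / 2 := by
      rw [deriv_div_const, deriv_id'']
    rw [this]
    linarith

/-- **Load-bearing clause of `CoreGluing`.**  With the threshold lowered below the Leray-drift value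
`1/2` the hypothesis is free, so the weakened crux IS the open target `RssProfileExists`
(¬ Perelman–Tsai–Pineau–Vicol RSS conjecture in the filament window): neither refutable nor provable
cheaply; a proof of `CoreGluing` must use `w′(τ*) ≥ 3/2 + δ`. [folklore] -/
theorem coreGluing_below_drift_iff_rssProfileExists {θ : ℝ} (hθ : θ < 1 / 2) :
    ((∃ (N : ℕ) (γ : Fin N → ℝ) (α δ ρ K : ℝ), 0 < N ∧ α ≠ 0 ∧ 0 < δ ∧ 0 < ρ ∧ (∀ j, γ j ≠ 0) ∧ ∀ Γ₀ : ℝ, ∃ Γ : ℝ, Γ₀ ≤ Γ ∧ 0 < Γ ∧ ∃ (Ξ : Fin N → ℝ → EuclideanSpace ℝ (Fin 3)) (w : Fin N → ℝ → ℝ), (∀ j, ContDiff ℝ 2 (Ξ j) ∧ Function.Injective (Ξ j) ∧ Differentiable ℝ (w j) ∧ (∀ τ, ‖deriv (Ξ j) τ‖ = 1) ∧ (∀ τ, ‖iteratedDeriv 2 (Ξ j) τ‖ * Real.sqrt Γ ≤ K) ∧ Filter.Tendsto (fun τ => ‖Ξ j τ‖) Filter.atTop Filter.atTop ∧ Filter.Tendsto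 (fun τ => ‖Ξ j τ‖) Filter.atBot Filter.atTop) ∧ (∀ j k, j ≠ k → ∀ τ σ, ρ * Real.sqrt Γ ≤ ‖Ξ j τ - Ξ k σ‖) ∧ (∀ j (x : EuclideanSpace ℝ (Fin 3)), MeasureTheory.Integrable (fun σ : ℝ => ((‖x - Ξ j σ‖ ^ 2 + 1) ^ (3 / 2 : ℝ))⁻¹ • Literature.Analysis.FluidPDE.cross (deriv (Ξ j) σ) (x - Ξ j σ))) ∧ (∀ j τ, (∑ k : Fin N, (Γ * γ k / (4 * Real.pi)) • ∫ σ : ℝ, ((‖Ξ j τ - Ξ k σ‖ ^ 2 + 1) ^ (3 / 2 : ℝ))⁻¹ • Literature.Analysis.FluidPDE.cross (deriv (Ξ k) σ) (Ξ j τ - Ξ k σ)) + (1 / 2 : ℝ) • Ξ j τ - α • Literature.Analysis.FluidPDE.cross (EuclideanSpace.single (2 : Fin 3) (1 : ℝ)) (Ξ j τ) = w j τ • deriv (Ξ j) τ) ∧ (∀ j, ∃ τs : ℝ, w j τs = 0 ∧ (∀ τ, w j τ = 0 → τ = τs) ∧ θ + δ ≤ deriv (w j) τs)) → RssProfileExists)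 ↔ RssProfileExists :=
  ⟨fun h => h (skeletonEquilibrium_holds_below_drift hθ), fun h _ => h⟩

end Summit.NavierStokesRegularity.NavierStokesRegularity.Theorems.CoreGluing.Negative
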